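import Literature.NumberTheory.EllipticCurves.FormalGroupXDerivativeProofs
import Mathlib.RingTheory.PowerSeries.Expand
import Mathlib.Algebra.Polynomial.Homogenize
import HarnessLib

/-!
# The Hasse invariant and the invariant differential: `ω = Σ cₙ zⁿ dz` has
# `c_{np-1} ≡ A·c_{n-1}^p (mod p)` (Atkin–Swinnerton-Dyer at level one; proofs only)

Trunk T-NT-EC (Literature/NumberTheory/EllipticCurves). Support file for the uniqueness half of the
named fact `WeierstrassCurve.mazur_tate_sigma_existsUnique` (`PadicSigma.lean`): after
`PadicSigmaUniquenessProofs.lean` the only arithmetic input left on the uniqueness side is that,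
at a prime `p ≥ 5` of good ORDINARY reduction, the coefficients `c_{p^k - 1}` of the invariant
differential `ω(z) = (Σ cₙ zⁿ) dz` of the (minimal) Weierstrass equation are `p`-adic units
(`WeierstrassCurve.unbounded_formalLog_of_norm_coeff_formalOmega_eq_one`). This file proves the
characteristic-`p` identity behind it, for an arbitrary Weierstrass equation over an arbitrary
commutative ring of odd prime characteristic `p`:

* `WeierstrassCurve.hasseCoeff W p` — **Deuring's / Hasse's polynomial** `A = A_p(W)`: the
  coefficient of `x^{p-1}` in `(4x³ + b₂x² + 2b₄x + b₆)^{(p-1)/2}` (`Ψ₂²`, Mathlib's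
  `twoTorsionPolynomial`); over `𝔽_p` it is the Hasse invariant and `A ≡ a_p (mod p)`
  (Silverman AEC V.4.1(a): "`a = A_q` as an equality in `𝔽_q`").
* `WeierstrassCurve.formalInvDiff W = (formalEta W)⁻¹ = ω/dz ∈ R⟦z⟧` over ANY ring (the tree's
  `formalOmega` is this series over `ℚ`-algebras, `formalInvDiff_eq_formalOmega`), and
  `WeierstrassCurve.formalYTilde W = z³(2y + a₁x + a₃) = (a₁z - 2)·z²x + a₃z³`.
* `WeierstrassCurve.coeff_formalInvDiff_mul_prime` — **the congruence of Atkin–Swinnerton-Dyer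
  type at level one, as an IDENTITY in characteristic `p`** (`p` an odd prime, `W` over any
  commutative ring `R` with `CharP R p`): for all `n ≥ 1`,
  `c_{np-1} = A · (c_{n-1})^p`, where `ω = Σ cₙ zⁿ dz`;
  hence `c_{p-1} = A` (Blakestad–Grant 2023, Remark after Prop. 3: "`H₁ … is the same as
  `w_{p-1}`", Deuring/Hasse) and `c_{p^k-1} = A^{1+p+⋯+p^{k-1}}` (`coeff_formalInvDiff_prime_pow`;
  Blakestad–Grant 2023, Prop. 3(b) proof and Lemma 4: `w_{pⁿ-1} = Hₙ ≡ H^{1+p+⋯+p^{n-1}}`).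

## The argument (Frobenius on `z³(2y + a₁x + a₃)`)

With `X = z²x(z)`, `Ỹ = z³(2y + a₁x + a₃)`, `η = dz/ω` one has over any ring (tree:
`FormalGroupXDerivativeProofs.lean`) `η·(zX' - 2X) = Ỹ` (this is `dx/ω = 2y + a₁x + a₃`) and
`Ỹ² = Φ := 4X³ + b₂z²X² + 2b₄z⁴X + b₆z⁶`. Hence with `p = 2m + 1`:
`ω · Ỹ^p = (zX' - 2X) · Φ^m` — the power-series form of `y^{p-1} dx = f(x)^{(p-1)/2} dx`.
In characteristic `p`, `Ỹ^p = Σ ỹⱼ^p z^{jp}`, so the coefficient of `z^{np-1}` on the left is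
`Σ_{j<n} ỹⱼ^p c_{(n-j)p-1}`. On the right, `Φ^m = Σ_{k+l=3m} A_k X^k z^{2l}` (homogenisation of
`Ψ₂²(x)^m`, `A_k` its coefficients, `A_{p-1} = A`), and the coefficient of `z^{np-1-2l}` in
`(zX' - 2X)X^k` vanishes unless `k = p - 1`: indeed `(k+1)·[z^e](zX'X^k) = e·[z^e](X^{k+1})`, and
`e ≡ 2k + 2 (mod p)`; for `k = p - 1` the universal identity `[z^{(n-1)p}](zX'X^{p-1}) =
(n-1)·[z^{(n-1)p}](X^p)` (proved over `ℤ[x₁, x₂, …]` and specialised) and `X^p = Σ xⱼ^p z^{jp}`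
give `(n-3)·x_{n-1}^p`. So `Σ_{j<n} ỹⱼ^p c_{(n-j)p-1} = (n-3)·A·x_{n-1}^p`; comparing with the
`p`-th power of the coefficient identity `Σ_{j<n} ỹⱼ c_{n-1-j} = (n-3)x_{n-1}` of `Ỹ·ω = zX' - 2X`
and inducting on `n` (`ỹ₀ = -2` is a unit) gives `c_{np-1} = A·c_{n-1}^p`.

## Sources

* J. H. Silverman, *AEC* 2nd ed. (2009), V.4.1(a) and its proof (`A_q`, `a = A_q` in `𝔽_q`),
  III.1 (`(2y + a₁x + a₃)² = 4x³ + b₂x² + 2b₄x + b₆`), IV.1 (`ω(z)`).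
* C. Blakestad, D. Grant, J. Number Theory 249 (2023) (arXiv:1903.02480), Prop. 3(b) and its
  proof, the Remark after Prop. 3 (`H`, `H₁ = w_{p-1}`), Lemma 4 (`w_{pⁿ-1} = Hₙ`).
* B. Mazur, W. Stein, J. Tate, Doc. Math. Extra Vol. Coates (2006), Thm. 1.3 (the consumer).

## Design notes

`ω` over a general ring is `formalInvDiff := invOfUnit formalEta 1` (`formalEta` has constant term
`1` and coefficients in `ℤ[a₁,…,a₆]`); it commutes with base change, so the identity over
`𝔽_p = ℤ/p` is the reduction of the `ℤ`- or `ℤ_p`-integral one. No named fact is introduced; the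
three definitions are data (`formalInvDiff`, `formalYTilde`, `hasseCoeff`).
-/

noncomputable section

open PowerSeries Literature.NumberTheory.EllipticCurves

namespace WeierstrassCurve

variable {R : Type*} [CommRing R] (W : WeierstrassCurve R)

/-! ### The objects -/

/-- **`Ỹ = z³(2y + a₁x + a₃) = (a₁z - 2)·X + a₃z³`** (`X = z²x(z)`, `z³y(z) = -X`): the expansion
of the `2`-division function `ψ₂ = 2y + a₁x + a₃` with its triple pole cleared.
[Silverman AEC III.1 (`ψ₂`), IV.1 (`x(z)`, `y(z)`)] [cite: SilvermanAEC2009, IV.1.1] -/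
def formalYTilde : R⟦X⟧ :=
  (C W.a₁ * X - 2) * W.formalXMulSq + C W.a₃ * X ^ 3

/-- **`ω(z)/dz ∈ R⟦z⟧` over any ring**: the inverse of `η = dz/ω = 1 - f_w(z, w(z))`
(`formalEta`, constant term `1`). Over a `ℚ`-algebra this is the tree's `formalOmega`
(`formalInvDiff_eq_formalOmega`). [Silverman AEC IV.1 (`ω(z) = (1 + a₁z + ⋯)dz ∈ ℤ[a₁,…,a₆]⟦z⟧dz`)]
[cite: SilvermanAEC2009, IV.1.1] -/
def formalInvDiff : R⟦X⟧ :=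
  invOfUnit W.formalEta 1

/-- **Hasse's polynomial `A_p(W)`** (Deuring's formula): the coefficient of `x^{p-1}` in
`(4x³ + b₂x² + 2b₄x + b₆)^{(p-1)/2} = Ψ₂²(x)^{(p-1)/2}`. In characteristic `p` (odd) it is the
Hasse invariant of `W`, and `a_p ≡ A_p (mod p)` for `W/𝔽_p`. [Silverman AEC V.4.1(a) (`A_q =`
coefficient of `x^{q-1}` in `f(x)^{(q-1)/2}`); Blakestad–Grant 2023, Remark after Prop. 3 (`H`)]
[cite: SilvermanAEC2009, V.4.1] -/
def hasseCoeff (p : ℕ) : R :=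
  (W.twoTorsionPolynomial.toPoly ^ ((p - 1) / 2)).coeff (p - 1)

/-! ### Identities over any ring -/

/-- Unfolding `formalYTilde`. [folklore] -/
theorem formalYTilde_def : W.formalYTilde = (C W.a₁ * X - 2) * W.formalXMulSq + C W.a₃ * X ^ 3 :=
  rfl

/-- `Ỹ(0) = -2`. [folklore] -/
@[simp] theorem constantCoeff_formalYTilde : constantCoeff W.formalYTilde = -2 := by
  have h2 : constantCoeff (2 : R⟦X⟧) = 2 := map_ofNat _ 2
  simp [formalYTilde, h2]

/-- `η · ω = 1`. [folklore] -/
theorem formalEta_mul_formalInvDiff : W.formalEta * W.formalInvDiff = 1 :=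
  mul_invOfUnit _ _ (by rw [constantCoeff_formalEta, Units.val_one])

/-- `ω · η = 1`. [folklore] -/
theorem formalInvDiff_mul_formalEta : W.formalInvDiff * W.formalEta = 1 := by
  rw [mul_comm, formalEta_mul_formalInvDiff]

/-- `ω(0) = 1`. [folklore] -/
@[simp] theorem constantCoeff_formalInvDiff : constantCoeff W.formalInvDiff = 1 := by
  rw [formalInvDiff, constantCoeff_invOfUnit, inv_one, Units.val_one]

/-- `Ỹ` commutes with base change. [folklore] -/
theorem map_formalYTilde {S : Type*} [CommRing S] (φ : R →+* S) :
    PowerSeries.map φ W.formalYTilde = (W.map φ).formalYTilde := by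
  simp only [formalYTilde, map_add, map_mul, map_sub, map_pow, PowerSeries.map_C,
    PowerSeries.map_X, W.map_formalXMulSq φ, map_ofNat]
  rfl

/-- `ω` commutes with base change. [folklore] -/
theorem map_formalInvDiff {S : Type*} [CommRing S] (φ : R →+* S) :
    PowerSeries.map φ W.formalInvDiff = (W.map φ).formalInvDiff := by
  rw [formalInvDiff, formalInvDiff, map_invOfUnit_one φ _ W.constantCoeff_formalEta, W.map_formalEta φ]

/-- Over a `ℚ`-algebra, `formalInvDiff` IS the tree's invariant differential `formalOmega`.
[Silverman AEC IV.1] [folklore] -/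
theorem formalInvDiff_eq_formalOmega {A : Type*} [CommRing A] [Algebra ℚ A] (V : WeierstrassCurve A) :
    V.formalInvDiff = V.formalOmega :=
  (left_inv_eq_right_inv V.formalOmega_mul_formalEta V.formalEta_mul_formalInvDiff).symm

/-- **`η · (zX' - 2X) = Ỹ`**, i.e. `dx/ω = 2y + a₁x + a₃` (from the tree's `z·D(X) = 2ηX + Ỹ`,
`D = η·d/dz`). [Blakestad–Grant 2023, §2 (`Dx = 2y` for `D = d/ω`); Silverman AEC III.1, IV.1]
[folklore] -/
theorem formalEta_mul_sub_eq_formalYTilde :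
    W.formalEta * (X * d⁄dX R W.formalXMulSq - 2 * W.formalXMulSq) = W.formalYTilde := by
  have h := W.X_mul_formalInvariantDerivation_formalXMulSq
  rw [formalInvariantDerivation_apply] at h
  rw [formalYTilde]
  linear_combination h

/-- **`Ỹ · ω = zX' - 2X`** (`ω = dz/η`). [folklore] -/
theorem formalYTilde_mul_formalInvDiff :
    W.formalYTilde * W.formalInvDiff = X * d⁄dX R W.formalXMulSq - 2 * W.formalXMulSq := by
  rw [← formalEta_mul_sub_eq_formalYTilde, mul_comm W.formalEta, mul_assoc,
    formalEta_mul_formalInvDiff, mul_one]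

/-- **`Ỹ² = Φ := 4X³ + b₂z²X² + 2b₄z⁴X + b₆z⁶`** (`(2y + a₁x + a₃)² = 4x³ + b₂x² + 2b₄x + b₆`
times `z⁶`). [Silverman AEC III.1] [folklore] -/
theorem formalYTilde_sq_eq :
    W.formalYTilde ^ 2 = 4 * W.formalXMulSq ^ 3 + C W.b₂ * X ^ 2 * W.formalXMulSq ^ 2 +
      2 * C W.b₄ * X ^ 4 * W.formalXMulSq + C W.b₆ * X ^ 6 :=
  W.formalYTilde_sq

/-- **`ω · Ỹ^{2m+1} = (zX' - 2X) · Φ^m`** — the pole-cleared form of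
`(2y + a₁x + a₃)^{2m} dx = Ψ₂²(x)^m dx`. [Silverman AEC V.4.1 (proof: `f(x)^{(q-1)/2}`)] [folklore] -/
theorem formalInvDiff_mul_formalYTilde_pow (m : ℕ) :
    W.formalInvDiff * W.formalYTilde ^ (2 * m + 1) =
      (X * d⁄dX R W.formalXMulSq - 2 * W.formalXMulSq) *
        (4 * W.formalXMulSq ^ 3 + C W.b₂ * X ^ 2 * W.formalXMulSq ^ 2 +
          2 * C W.b₄ * X ^ 4 * W.formalXMulSq + C W.b₆ * X ^ 6) ^ m := by
  rw [← formalYTilde_sq_eq, ← formalYTilde_mul_formalInvDiff, ← pow_mul, pow_succ]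
  ring

/-! ### A coefficient identity: `(k+1)·[z^e](zf'f^k) = e·[z^e](f^{k+1})` -/

/-- **`(k+1)·[z^e](z f' f^k) = e·[z^e](f^{k+1})`** (Leibniz: `z(f^{k+1})' = (k+1) z f' f^k`, and
`[z^e](z·g') = e·[z^e]g` — the latter is the tree's
`…AlgFunctionField.LPolynomial.coeff_X_mul_derivative`, re-derived inline to keep imports light).
[folklore] -/
theorem succ_mul_coeff_X_mul_derivative_mul_pow (f : R⟦X⟧) (k e : ℕ) :
    ((k : R) + 1) * coeff e (X * d⁄dX R f * f ^ k) = (e : R) * coeff e (f ^ (k + 1)) := by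
  have hXd : ∀ g : R⟦X⟧, coeff e (X * d⁄dX R g) = (e : R) * coeff e g := fun g => by
    rcases e with _ | e
    · simp
    · rw [coeff_succ_X_mul, coeff_derivative, mul_comm]
      push_cast
      ring
  have h : X * d⁄dX R (f ^ (k + 1)) = ((k : R⟦X⟧) + 1) * (X * d⁄dX R f * f ^ k) := by
    rw [derivative_pow, Nat.add_sub_cancel]
    push_cast
    ring
  rw [← hXd, h, show ((k : R⟦X⟧) + 1) = C ((k : R) + 1) by
    rw [map_add, map_natCast, map_one], coeff_C_mul]

/-- **`[z^{np}](z f' f^{p-1}) = n·[z^{np}](f^p)` over ANY ring** (`p ≥ 1`): by the previous lemma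
`p·[z^{np}](zf'f^{p-1}) = np·[z^{np}](f^p)`; the factor `p` is cancelled in the universal case
`f = Σ xᵢ zⁱ` over the domain `ℤ[x₀, x₁, …]` of characteristic `0`, and the identity is then
specialised along `xᵢ ↦ coeff i f`. [folklore] -/
theorem coeff_X_mul_derivative_mul_pow_eq (f : R⟦X⟧) {p : ℕ} (hp : p ≠ 0) (n : ℕ) :
    coeff (n * p) (X * d⁄dX R f * f ^ (p - 1)) = (n : R) * coeff (n * p) (f ^ p) := by
  -- the universal series `F = Σ xᵢ zⁱ` over `S = ℤ[xᵢ : i ∈ ℕ]`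
  set S := MvPolynomial ℕ ℤ
  set F : S⟦X⟧ := PowerSeries.mk fun i => (MvPolynomial.X i : S) with hF
  have hp1 : p - 1 + 1 = p := Nat.succ_pred_eq_of_ne_zero hp
  have huniv : coeff (n * p) (X * d⁄dX S F * F ^ (p - 1)) = (n : S) * coeff (n * p) (F ^ p) := by
    have h := succ_mul_coeff_X_mul_derivative_mul_pow F (p - 1) (n * p)
    rw [hp1] at h
    have hcast : ((p - 1 : ℕ) : S) + 1 = (p : S) := by exact_mod_cast hp1
    rw [hcast, Nat.cast_mul, show (n : S) * (p : S) * coeff (n * p) (F ^ p) =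
      (p : S) * ((n : S) * coeff (n * p) (F ^ p)) by ring] at h
    exact mul_left_cancel₀ (Nat.cast_ne_zero.mpr hp) h
  -- specialise along `xᵢ ↦ coeff i f`
  set φ : S →+* R := MvPolynomial.eval₂Hom (Int.castRingHom R) fun i => coeff i f with hφ
  have hFf : PowerSeries.map φ F = f := by
    ext i
    rw [coeff_map, hF, coeff_mk, hφ, MvPolynomial.eval₂Hom_X']
  have h := congrArg φ huniv
  rw [map_mul φ, map_natCast φ, ← coeff_map, ← coeff_map, map_mul (PowerSeries.map φ),
    map_mul (PowerSeries.map φ), map_pow (PowerSeries.map φ), map_pow (PowerSeries.map φ),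
    PowerSeries.map_X, ← derivative_map, hFf] at h
  exact h

/-! ### Characteristic `p`: coefficients of `p`-th powers -/

section CharP

variable (p : ℕ) [Fact p.Prime] [CharP R p]

/-- **Freshman's dream for power series**: in characteristic `p`, `(Σ aₙ zⁿ)^p = Σ aₙ^p z^{np}`;
coefficientwise `[zⁿ](f^p) = a_{n/p}^p` if `p ∣ n` and `0` otherwise (Mathlib:
`MvPowerSeries.map_frobenius_expand`). [folklore] -/
theorem coeff_pow_prime (f : R⟦X⟧) (n : ℕ) :
    coeff n (f ^ p) = if p ∣ n then (coeff (n / p) f) ^ p else 0 := by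
  have hp : p ≠ 0 := (Fact.out : p.Prime).ne_zero
  have h : f ^ p = PowerSeries.map (frobenius R p) (PowerSeries.expand p hp f) :=
    (MvPowerSeries.map_frobenius_expand p hp).symm
  rw [h, coeff_map, coeff_expand]
  split_ifs
  · rfl
  · exact map_zero _

/-- `[z^{np}](f^p) = aₙ^p` in characteristic `p`. [folklore] -/
theorem coeff_mul_pow_prime (f : R⟦X⟧) (n : ℕ) : coeff (n * p) (f ^ p) = (coeff n f) ^ p := by
  have hp : 0 < p := (Fact.out : p.Prime).pos
  rw [coeff_pow_prime, if_pos (Dvd.intro_left n rfl), Nat.mul_div_cancel _ hp]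

/-- **`[z^N](g · f^p) = Σ_{j ≤ N/p} [z^{N-pj}]g · ([zʲ]f)^p`** in characteristic `p` (only the
exponents of `f^p` divisible by `p` contribute). [folklore] -/
theorem coeff_mul_pow_prime_eq_sum (g f : R⟦X⟧) (N : ℕ) :
    coeff N (g * f ^ p) =
      ∑ j ∈ Finset.range (N / p + 1), coeff (N - p * j) g * (coeff j f) ^ p := by
  have hp : 0 < p := (Fact.out : p.Prime).pos
  rw [coeff_mul]
  -- kill the terms with `p ∤ j`
  have h1 : ∑ x ∈ Finset.antidiagonal N, coeff x.1 g * coeff x.2 (f ^ p) =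
      ∑ x ∈ (Finset.antidiagonal N).filter (fun x => p ∣ x.2),
        coeff x.1 g * (coeff (x.2 / p) f) ^ p := by
    rw [Finset.sum_filter]
    refine Finset.sum_congr rfl fun x _ => ?_
    rw [coeff_pow_prime]
    split_ifs <;> simp
  -- reindex by `j ↦ (N - pj, pj)`
  have h2 : (Finset.antidiagonal N).filter (fun x => p ∣ x.2) =
      (Finset.range (N / p + 1)).image fun j => (N - p * j, p * j) := by
    ext ⟨a, b⟩
    simp only [Finset.mem_filter, Finset.mem_antidiagonal, Finset.mem_image, Finset.mem_range,
      Prod.mk.injEq]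
    constructor
    · rintro ⟨hab, c, rfl⟩
      refine ⟨c, ?_, by omega, rfl⟩
      have : c ≤ N / p := (Nat.le_div_iff_mul_le hp).mpr (by nlinarith)
      omega
    · rintro ⟨j, hj, rfl, rfl⟩
      have hj' : j ≤ N / p := by omega
      have : p * j ≤ N := by
        have := (Nat.le_div_iff_mul_le hp).mp hj'
        nlinarith
      exact ⟨by omega, Dvd.intro j rfl⟩
  rw [h1, h2, Finset.sum_image]
  · refine Finset.sum_congr rfl fun j _ => ?_
    rw [Nat.mul_div_cancel_left _ hp]
  · intro x _ y _ hxy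
    simp only [Prod.mk.injEq] at hxy
    exact Nat.eq_of_mul_eq_mul_left hp hxy.2

/-- In characteristic `p`, a natural number prime to `p` is a unit. [folklore] -/
theorem _root_.Literature.NumberTheory.EllipticCurves.isUnit_natCast_of_not_dvd {a : ℕ}
    (ha : ¬ p ∣ a) : IsUnit ((a : ℕ) : R) := by
  have hz : (a : ZMod p) ≠ 0 := fun h => ha ((ZMod.natCast_eq_zero_iff a p).mp h)
  have hu : IsUnit (a : ZMod p) := isUnit_iff_ne_zero.mpr hz
  have := hu.map (ZMod.castHom (dvd_refl p) R)
  rwa [map_natCast] at this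

end CharP

/-! ### `Φ^m = Σ_{k+l=3m} A_k X^k z^{2l}`: homogenising `Ψ₂²(x)^m` -/

section Homogenize

/-- The evaluation `x₀ ↦ X = z²x(z)`, `x₁ ↦ z²` of bivariate polynomials in `R⟦z⟧`. [folklore] -/
def evalXZsq : MvPolynomial (Fin 2) R →+* R⟦X⟧ :=
  MvPolynomial.eval₂Hom (C : R →+* R⟦X⟧) ![W.formalXMulSq, X ^ 2]

/-- `evalXZsq` on the variables. [folklore] -/
@[simp] theorem evalXZsq_X_zero : W.evalXZsq (MvPolynomial.X 0) = W.formalXMulSq := by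
  rw [evalXZsq, MvPolynomial.eval₂Hom_X']; rfl

/-- `evalXZsq` on the variables. [folklore] -/
@[simp] theorem evalXZsq_X_one : W.evalXZsq (MvPolynomial.X 1) = X ^ 2 := by
  rw [evalXZsq, MvPolynomial.eval₂Hom_X']; rfl

/-- `evalXZsq` on constants. [folklore] -/
@[simp] theorem evalXZsq_C (r : R) : W.evalXZsq (MvPolynomial.C r) = C r := by
  rw [evalXZsq, MvPolynomial.eval₂Hom_C]

/-- **`Φ = z⁶·Ψ₂²(X/z²)`**: evaluating the homogenisation of `Ψ₂² = 4x³ + b₂x² + 2b₄x + b₆`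
(Mathlib's `twoTorsionPolynomial`) at `(X, z²)` gives `4X³ + b₂z²X² + 2b₄z⁴X + b₆z⁶`. [Silverman
AEC III.1 (`Ψ₂²`)] [folklore] -/
theorem evalXZsq_homogenize_twoTorsionPolynomial :
    W.evalXZsq (W.twoTorsionPolynomial.toPoly.homogenize 3) =
      4 * W.formalXMulSq ^ 3 + C W.b₂ * X ^ 2 * W.formalXMulSq ^ 2 +
        2 * C W.b₄ * X ^ 4 * W.formalXMulSq + C W.b₆ * X ^ 6 := by
  have hT : W.twoTorsionPolynomial.toPoly = Polynomial.C 4 * Polynomial.X ^ 3 +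
      Polynomial.C W.b₂ * Polynomial.X ^ 2 + Polynomial.C (2 * W.b₄) * Polynomial.X +
      Polynomial.C W.b₆ := rfl
  rw [hT, Polynomial.homogenize_add, Polynomial.homogenize_add, Polynomial.homogenize_add,
    Polynomial.homogenize_C_mul, Polynomial.homogenize_C_mul, Polynomial.homogenize_C_mul,
    Polynomial.homogenize_C, Polynomial.homogenize_X_pow (le_refl 3),
    Polynomial.homogenize_X_pow (show 2 ≤ 3 by norm_num),
    Polynomial.homogenize_X (show (3 : ℕ) ≠ 0 by norm_num)]
  simp only [map_add, map_mul, map_pow, evalXZsq_X_zero, evalXZsq_X_one, evalXZsq_C,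
    Nat.sub_self, pow_zero, mul_one, show (3 : ℕ) - 2 = 1 from rfl,
    show (3 : ℕ) - 1 = 2 from rfl, pow_one, map_ofNat]
  ring

/-- Homogenisation is multiplicative on powers of the cubic `Ψ₂²`. [folklore] -/
theorem homogenize_twoTorsionPolynomial_pow (m : ℕ) :
    (W.twoTorsionPolynomial.toPoly ^ m).homogenize (3 * m) =
      (W.twoTorsionPolynomial.toPoly.homogenize 3) ^ m := by
  have hdeg : W.twoTorsionPolynomial.toPoly.natDegree ≤ 3 := Polynomial.natDegree_cubic_le
  induction m with
  | zero => simp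
  | succ m ih =>
    rw [pow_succ, pow_succ, show 3 * (m + 1) = 3 * m + 3 by ring,
      Polynomial.homogenize_mul _ _ ((Polynomial.natDegree_pow_le).trans (by
        calc m * W.twoTorsionPolynomial.toPoly.natDegree ≤ m * 3 :=
              Nat.mul_le_mul_left m hdeg
          _ = 3 * m := by ring)) hdeg, ih]

/-- **`Φ^m` is the evaluation at `(X, z²)` of the homogenisation of `Ψ₂²(x)^m`.** [folklore] -/
theorem phi_pow_eq_evalXZsq (m : ℕ) :
    (4 * W.formalXMulSq ^ 3 + C W.b₂ * X ^ 2 * W.formalXMulSq ^ 2 +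
        2 * C W.b₄ * X ^ 4 * W.formalXMulSq + C W.b₆ * X ^ 6) ^ m =
      W.evalXZsq ((W.twoTorsionPolynomial.toPoly ^ m).homogenize (3 * m)) := by
  rw [homogenize_twoTorsionPolynomial_pow, map_pow, evalXZsq_homogenize_twoTorsionPolynomial]

/-- **Expansion of an evaluated bivariate polynomial**: `ev(H) = Σ_{d ∈ supp H} H_d · X^{d₀} (z²)^{d₁}`.
[folklore] -/
theorem evalXZsq_eq_sum (H : MvPolynomial (Fin 2) R) :
    W.evalXZsq H = ∑ d ∈ H.support,
      C (MvPolynomial.coeff d H) * (W.formalXMulSq ^ d 0 * (X ^ 2) ^ d 1) := by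
  rw [evalXZsq, MvPolynomial.coe_eval₂Hom, MvPolynomial.eval₂_eq']
  refine Finset.sum_congr rfl fun d _ => ?_
  rw [Fin.prod_univ_two]
  rfl

end Homogenize

/-! ### The coefficient of `z^{np-1}` in `(zX' - 2X)·Φ^m` -/

section RightHandSide

variable (p : ℕ) [Fact p.Prime] [CharP R p]

/-- Off the critical exponent the monomials contribute nothing: for `k + l = 3m`, `k ≠ p - 1`
(`p = 2m + 1`), `[z^{n'p + p - 1}]((zX' - 2X) · X^k z^{2l}) = 0` — because
`(k+1)·[z^e](zX'X^k) = e·[z^e](X^{k+1})` with `e ≡ 2k + 2 (mod p)` and `k + 1 ∈ Rˣ`. [folklore] -/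
theorem coeff_sub_mul_monomial_eq_zero {m : ℕ} (hpm : p = 2 * m + 1) {k l : ℕ}
    (hkl : k + l = 3 * m) (hk : k ≠ p - 1) (n' : ℕ) :
    coeff (n' * p + (p - 1)) ((X * d⁄dX R W.formalXMulSq - 2 * W.formalXMulSq) *
      (W.formalXMulSq ^ k * (X ^ 2) ^ l)) = 0 := by
  set Xs := W.formalXMulSq with hXs
  set N := n' * p + (p - 1) with hN
  rw [← pow_mul, show (X * d⁄dX R Xs - 2 * Xs) * (Xs ^ k * X ^ (2 * l)) =
    ((X * d⁄dX R Xs - 2 * Xs) * Xs ^ k) * X ^ (2 * l) by ring, coeff_mul_X_pow']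
  split_ifs with h2l
  · set e := N - 2 * l with he
    have heN : e + 2 * l = N := Nat.sub_add_cancel h2l
    have hp1 : 1 ≤ p := (Fact.out : p.Prime).one_lt.le
    have hN1 : N + 1 = n' * p + p := by omega
    -- `e ≡ 2k + 2 (mod p)`
    have hnat : e + 2 * p = n' * p + 2 * k + 2 := by omega
    have hcast : (e : R) = 2 * (k : R) + 2 := by
      have h := congrArg (Nat.cast : ℕ → R) hnat
      push_cast at h
      rw [CharP.cast_eq_zero R p] at h
      linear_combination h
    -- `(k+1)·c = e·d`, hence `(k+1)(c - 2d) = 0`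
    have hcd := succ_mul_coeff_X_mul_derivative_mul_pow Xs k e
    have hexp : (X * d⁄dX R Xs - 2 * Xs) * Xs ^ k = X * d⁄dX R Xs * Xs ^ k - C (2 : R) * Xs ^ (k + 1) := by
      rw [map_ofNat]; ring
    rw [hexp, map_sub, coeff_C_mul]
    have hk1 : ¬ p ∣ (k + 1) := by
      rintro ⟨c, hc⟩
      rcases Nat.lt_or_ge c 2 with hc2 | hc2
      · interval_cases c
        · omega
        · exact hk (by omega)
      · have : p * c ≥ p * 2 := Nat.mul_le_mul_left p hc2
        omega
    have hu : IsUnit ((k : R) + 1) := by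
      have := isUnit_natCast_of_not_dvd (R := R) p hk1
      push_cast at this
      exact this
    refine (hu.mul_right_eq_zero).mp ?_
    linear_combination hcd + coeff e (Xs ^ (k + 1)) * hcast
  · rfl

/-- At the critical exponent `(k, l) = (p - 1, m)`:
`[z^{n'p + p - 1}]((zX' - 2X) · X^{p-1} z^{2m}) = (n' - 2)·x_{n'}^p` (`X = Σ xᵢ zⁱ`), by the
universal identity `[z^{n'p}](zX'X^{p-1}) = n'·[z^{n'p}](X^p)` and `[z^{n'p}](X^p) = x_{n'}^p`.
[folklore] -/
theorem coeff_sub_mul_monomial_critical {m : ℕ} (hpm : p = 2 * m + 1) (n' : ℕ) :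
    coeff (n' * p + (p - 1)) ((X * d⁄dX R W.formalXMulSq - 2 * W.formalXMulSq) *
      (W.formalXMulSq ^ (p - 1) * (X ^ 2) ^ m)) =
        ((n' : R) - 2) * (coeff n' W.formalXMulSq) ^ p := by
  set Xs := W.formalXMulSq with hXs
  have hp0 : p ≠ 0 := (Fact.out : p.Prime).ne_zero
  have h2m : 2 * m = p - 1 := by omega
  rw [← pow_mul, h2m, show (X * d⁄dX R Xs - 2 * Xs) * (Xs ^ (p - 1) * X ^ (p - 1)) =
    ((X * d⁄dX R Xs - 2 * Xs) * Xs ^ (p - 1)) * X ^ (p - 1) by ring, coeff_mul_X_pow',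
    if_pos (Nat.le_add_left _ _), Nat.add_sub_cancel]
  have hp1 : p - 1 + 1 = p := Nat.succ_pred_eq_of_ne_zero hp0
  have hXp : Xs ^ p = Xs ^ (p - 1) * Xs := by
    conv_lhs => rw [← hp1]
    exact pow_succ _ _
  have hexp : (X * d⁄dX R Xs - 2 * Xs) * Xs ^ (p - 1) =
      X * d⁄dX R Xs * Xs ^ (p - 1) - C (2 : R) * Xs ^ p := by
    rw [map_ofNat, hXp]
    ring
  rw [hexp, map_sub, coeff_C_mul, coeff_X_mul_derivative_mul_pow_eq Xs hp0 n',
    coeff_mul_pow_prime p Xs n']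
  ring

/-- **The coefficient of `z^{n'p + p - 1}` in `(zX' - 2X)·Φ^m` is `A·(n' - 2)·x_{n'}^p`**
(`p = 2m + 1`, `A = hasseCoeff`): in `Φ^m = Σ_{k+l=3m} A_k X^k z^{2l}` only the critical monomial
`k = p - 1` survives. [Silverman AEC V.4.1 (proof: only `x^{q-1}` contributes)] [folklore] -/
theorem coeff_sub_mul_phi_pow {m : ℕ} (hpm : p = 2 * m + 1) (n' : ℕ) :
    coeff (n' * p + (p - 1)) ((X * d⁄dX R W.formalXMulSq - 2 * W.formalXMulSq) *
      (4 * W.formalXMulSq ^ 3 + C W.b₂ * X ^ 2 * W.formalXMulSq ^ 2 +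
        2 * C W.b₄ * X ^ 4 * W.formalXMulSq + C W.b₆ * X ^ 6) ^ m) =
      W.hasseCoeff p * (((n' : R) - 2) * (coeff n' W.formalXMulSq) ^ p) := by
  rw [phi_pow_eq_evalXZsq, evalXZsq_eq_sum, Finset.mul_sum, map_sum]
  set F := X * d⁄dX R W.formalXMulSq - 2 * W.formalXMulSq with hF
  set T := W.twoTorsionPolynomial.toPoly with hT
  set H := (T ^ m).homogenize (3 * m) with hH
  have hterm : ∀ d : Fin 2 →₀ ℕ, coeff (n' * p + (p - 1))
      (F * (C (MvPolynomial.coeff d H) * (W.formalXMulSq ^ d 0 * (X ^ 2) ^ d 1))) =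
        MvPolynomial.coeff d H * coeff (n' * p + (p - 1)) (F * (W.formalXMulSq ^ d 0 * (X ^ 2) ^ d 1)) := by
    intro d
    rw [show F * (C (MvPolynomial.coeff d H) * (W.formalXMulSq ^ d 0 * (X ^ 2) ^ d 1)) =
      C (MvPolynomial.coeff d H) * (F * (W.formalXMulSq ^ d 0 * (X ^ 2) ^ d 1)) by ring, coeff_C_mul]
  simp only [hterm]
  -- the critical exponent
  set d₀ : Fin 2 →₀ ℕ := Finsupp.single 0 (p - 1) + Finsupp.single 1 m with hd₀
  have hd₀0 : d₀ 0 = p - 1 := by simp [hd₀]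
  have hd₀1 : d₀ 1 = m := by simp [hd₀]
  have hcoeff : ∀ d : Fin 2 →₀ ℕ, MvPolynomial.coeff d H =
      if d 0 + d 1 = 3 * m then (T ^ m).coeff (d 0) else 0 := fun d => Polynomial.coeff_homogenize _ _ d
  have hm : (p - 1) / 2 = m := by omega
  have hA : MvPolynomial.coeff d₀ H = W.hasseCoeff p := by
    rw [hcoeff, hd₀0, hd₀1, if_pos (by omega), hasseCoeff, hm]
  rw [Finset.sum_eq_single d₀]
  · rw [hA, hd₀0, hd₀1, W.coeff_sub_mul_monomial_critical p hpm n']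
  · intro b hb hne
    have hb' : MvPolynomial.coeff b H ≠ 0 := MvPolynomial.mem_support_iff.mp hb
    have hsum : b 0 + b 1 = 3 * m := by
      by_contra h
      rw [hcoeff, if_neg h] at hb'
      exact hb' rfl
    have hk : b 0 ≠ p - 1 := by
      intro h0
      apply hne
      ext i
      fin_cases i
      · simp [hd₀0, h0]
      · simp only [Fin.mk_one, hd₀1]
        omega
    rw [W.coeff_sub_mul_monomial_eq_zero p hpm hsum hk n', mul_zero]
  · intro h
    rw [MvPolynomial.notMem_support_iff.mp h, zero_mul]

end RightHandSide

/-! ### The theorem: `c_{np-1} = A·c_{n-1}^p` in characteristic `p` -/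

section Main

variable (p : ℕ) [Fact p.Prime] [CharP R p]

/-- `[z^{n'}](Ỹ·ω) = (n' - 2)·x_{n'}` — the coefficients of `Ỹ·ω = zX' - 2X`. [folklore] -/
theorem sum_coeff_formalYTilde_mul_coeff_formalInvDiff (n' : ℕ) :
    ∑ j ∈ Finset.range (n' + 1), coeff j W.formalYTilde * coeff (n' - j) W.formalInvDiff =
      ((n' : R) - 2) * coeff n' W.formalXMulSq := by
  have h := congrArg (coeff n') W.formalYTilde_mul_formalInvDiff
  have hXd : coeff n' (X * d⁄dX R W.formalXMulSq) = (n' : R) * coeff n' W.formalXMulSq := by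
    have h1 := succ_mul_coeff_X_mul_derivative_mul_pow W.formalXMulSq 0 n'
    rwa [Nat.cast_zero, zero_add, one_mul, pow_zero, mul_one, zero_add, pow_one] at h1
  rw [coeff_mul, Finset.Nat.sum_antidiagonal_eq_sum_range_succ_mk, map_sub, hXd,
    show (2 : R⟦X⟧) * W.formalXMulSq = C (2 : R) * W.formalXMulSq by rw [map_ofNat],
    coeff_C_mul] at h
  rw [h]
  ring

/-- **The left-hand side**: `[z^{n'p+p-1}](ω · Ỹ^p) = Σ_{j ≤ n'} c_{n'p+p-1-pj} · ỹⱼ^p` in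
characteristic `p`. [folklore] -/
theorem coeff_formalInvDiff_mul_formalYTilde_pow_prime (n' : ℕ) :
    coeff (n' * p + (p - 1)) (W.formalInvDiff * W.formalYTilde ^ p) =
      ∑ j ∈ Finset.range (n' + 1),
        coeff (n' * p + (p - 1) - p * j) W.formalInvDiff * (coeff j W.formalYTilde) ^ p := by
  have hp1 : 1 ≤ p := (Fact.out : p.Prime).one_lt.le
  have hdiv : (n' * p + (p - 1)) / p = n' :=
    Nat.div_eq_of_lt_le (Nat.le_add_right _ _) (by rw [Nat.succ_mul]; omega)
  rw [coeff_mul_pow_prime_eq_sum, hdiv]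

/-- **`c_{n'p + p - 1} = A · c_{n'}^p` in characteristic `p`** (`p` an odd prime, `W` over any
commutative ring `R` of characteristic `p`, `ω = Σ cₙ zⁿ dz = formalInvDiff`,
`A = hasseCoeff W p`): the level-one case of the congruences of Atkin–Swinnerton-Dyer type for the
invariant differential, as an identity in characteristic `p`. For `n' = 0` this is
Deuring's/Hasse's `c_{p-1} = A` (the Hasse invariant is the `z^{p-1}`-coefficient of `ω`), and
iterating, `c_{p^k-1} = A^{1+p+⋯+p^{k-1}}`. Proof: the Frobenius argument of the module
docstring, by strong induction on `n'`. [Blakestad–Grant 2023, Prop. 3(b) (proof) and Lemma 4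
(`w_{pⁿ-1} = Hₙ`), Remark after Prop. 3 (`H₁ = w_{p-1}`); Silverman AEC V.4.1(a)]
[cite: BlakestadGrant2023, Lemma 4] -/
theorem coeff_formalInvDiff_mul_prime {m : ℕ} (hpm : p = 2 * m + 1) (n' : ℕ) :
    coeff (n' * p + (p - 1)) W.formalInvDiff =
      W.hasseCoeff p * (coeff n' W.formalInvDiff) ^ p := by
  induction n' using Nat.strong_induction_on with
  | _ n' ih =>
    have hp : p.Prime := Fact.out
    -- (E1) the coefficient of `z^{n'p+p-1}` in `ω·Ỹ^p = (zX' - 2X)·Φ^m`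
    have E1 : ∑ j ∈ Finset.range (n' + 1),
        coeff (n' * p + (p - 1) - p * j) W.formalInvDiff * (coeff j W.formalYTilde) ^ p =
          W.hasseCoeff p * (((n' : R) - 2) * (coeff n' W.formalXMulSq) ^ p) := by
      rw [← coeff_formalInvDiff_mul_formalYTilde_pow_prime, hpm,
        W.formalInvDiff_mul_formalYTilde_pow m, ← hpm, W.coeff_sub_mul_phi_pow p hpm n']
    -- (E2) the `p`-th power of the coefficient identity for `Ỹ·ω = zX' - 2X`
    have E2 : ∑ j ∈ Finset.range (n' + 1),
        (coeff j W.formalYTilde) ^ p * (coeff (n' - j) W.formalInvDiff) ^ p =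
          ((n' : R) - 2) * (coeff n' W.formalXMulSq) ^ p := by
      have h := congrArg (frobenius R p) (W.sum_coeff_formalYTilde_mul_coeff_formalInvDiff n')
      rw [map_sum] at h
      simpa only [map_mul, map_sub, map_natCast, map_ofNat, frobenius_def] using h
    rw [Finset.sum_range_succ'] at E1 E2
    -- the inner sum of (E1) is `A ·` the inner sum of (E2), by induction
    have hinner : ∑ j ∈ Finset.range n',
        coeff (n' * p + (p - 1) - p * (j + 1)) W.formalInvDiff * (coeff (j + 1) W.formalYTilde) ^ p =
          W.hasseCoeff p * ∑ j ∈ Finset.range n',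
            (coeff (j + 1) W.formalYTilde) ^ p * (coeff (n' - (j + 1)) W.formalInvDiff) ^ p := by
      rw [Finset.mul_sum]
      refine Finset.sum_congr rfl fun j hj => ?_
      obtain ⟨r, hr⟩ := Nat.exists_eq_add_of_lt (Finset.mem_range.mp hj)
      have hidx : n' * p + (p - 1) - p * (j + 1) = r * p + (p - 1) :=
        Nat.sub_eq_of_eq_add (by subst hr; ring)
      have hsub : n' - (j + 1) = r := by omega
      rw [hidx, hsub, ih r (by omega)]
      ring
    rw [hinner, mul_zero, Nat.sub_zero] at E1
    rw [Nat.sub_zero] at E2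
    -- `ỹ₀ = -2` is a unit (`p` odd)
    have hy0 : coeff 0 W.formalYTilde = -2 := by
      rw [coeff_zero_eq_constantCoeff_apply, constantCoeff_formalYTilde]
    have hunit : IsUnit ((coeff 0 W.formalYTilde) ^ p) := by
      rw [hy0]
      refine IsUnit.pow p (IsUnit.neg ?_)
      have h2 : ¬ p ∣ 2 := fun h => by
        have := (Nat.prime_dvd_prime_iff_eq hp Nat.prime_two).mp h
        omega
      have := isUnit_natCast_of_not_dvd (R := R) p h2
      rwa [Nat.cast_ofNat] at this
    have key : (coeff (n' * p + (p - 1)) W.formalInvDiff -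
        W.hasseCoeff p * (coeff n' W.formalInvDiff) ^ p) * (coeff 0 W.formalYTilde) ^ p = 0 := by
      linear_combination E1 - W.hasseCoeff p * E2
    exact sub_eq_zero.mp ((hunit.mul_left_eq_zero).mp key)

/-- **Deuring/Hasse: `c_{p-1} = A`** — the Hasse invariant is the coefficient of `z^{p-1}` in the
invariant differential `ω = Σ cₙ zⁿ dz`. [Blakestad–Grant 2023, Remark after Prop. 3
("`H₁ … is the same as `w_{p-1}` [Has]"); Silverman AEC V.4.1(a)] [cite: BlakestadGrant2023, Prop. 3] -/
theorem coeff_formalInvDiff_prime_sub_one {m : ℕ} (hpm : p = 2 * m + 1) :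
    coeff (p - 1) W.formalInvDiff = W.hasseCoeff p := by
  have h := W.coeff_formalInvDiff_mul_prime p hpm 0
  rwa [zero_mul, zero_add, coeff_zero_eq_constantCoeff_apply, constantCoeff_formalInvDiff, one_pow,
    mul_one] at h

/-- **`c_{p^k-1} = A^{1+p+⋯+p^{k-1}}`** in characteristic `p`. [Blakestad–Grant 2023, Prop. 3(b)
(proof: `Hₙ ≡ H₁^{1+p+⋯+p^{n-1}}`) and Lemma 4 (`w_{pⁿ-1} = Hₙ`)] [cite: BlakestadGrant2023, Lemma 4] -/
theorem coeff_formalInvDiff_prime_pow_sub_one {m : ℕ} (hpm : p = 2 * m + 1) (k : ℕ) :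
    coeff (p ^ k - 1) W.formalInvDiff = W.hasseCoeff p ^ (∑ i ∈ Finset.range k, p ^ i) := by
  have hp : p.Prime := Fact.out
  induction k with
  | zero => simp
  | succ k ih =>
    have h1 : 1 ≤ p ^ k := Nat.one_le_pow _ _ hp.pos
    have h2 : 1 ≤ p := hp.one_lt.le
    have h3 : 1 ≤ p ^ (k + 1) := Nat.one_le_pow _ _ hp.pos
    have hidx : p ^ (k + 1) - 1 = (p ^ k - 1) * p + (p - 1) := by
      zify [h1, h2, h3]
      ring
    rw [hidx, W.coeff_formalInvDiff_mul_prime p hpm, ih, ← pow_mul, ← pow_succ']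
    congr 1
    rw [Finset.sum_range_succ', pow_zero, Finset.sum_mul]
    exact (congrArg (· + 1) (Finset.sum_congr rfl fun i _ => pow_succ p i)).symm

end Main

/-! ### Base change and the integral form: `p ∤ c_{p^k-1}` when `A ≢ 0 (mod p)` -/

/-- `A_p` commutes with base change. [folklore] -/
theorem map_hasseCoeff {S : Type*} [CommRing S] (φ : R →+* S) (p : ℕ) :
    (W.map φ).hasseCoeff p = φ (W.hasseCoeff p) := by
  have h : (W.map φ).twoTorsionPolynomial.toPoly = Polynomial.map φ W.twoTorsionPolynomial.toPoly := by
    rw [← Cubic.map_toPoly]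
    simp only [twoTorsionPolynomial, Cubic.map, map_b₂, map_b₄, map_b₆, map_ofNat, map_mul]
  rw [hasseCoeff, hasseCoeff, h, ← Polynomial.map_pow, Polynomial.coeff_map]

/-- **`p ∤ c_{p^k-1}(V)` for an integral equation `V/ℤ` whose Hasse invariant mod `p` is nonzero**
(`p` an odd prime; `c_{p^k-1} ≡ A^{1+p+⋯+p^{k-1}} (mod p)`). [Blakestad–Grant 2023, Prop. 3(b) and
Lemma 4 (`Hₙ`, `w_{pⁿ-1}` units)] [cite: BlakestadGrant2023, Lemma 4] -/
theorem not_dvd_coeff_formalInvDiff_of_hasseCoeff_ne_zero (V : WeierstrassCurve ℤ) (p : ℕ)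
    [Fact p.Prime] (hp2 : p ≠ 2) (hA : (V.map (Int.castRingHom (ZMod p))).hasseCoeff p ≠ 0)
    (k : ℕ) : ¬ (p : ℤ) ∣ coeff (p ^ k - 1) V.formalInvDiff := by
  have hp : p.Prime := Fact.out
  obtain ⟨m, hpm⟩ : ∃ m, p = 2 * m + 1 := hp.eq_two_or_odd'.resolve_left hp2
  rw [← ZMod.intCast_zmod_eq_zero_iff_dvd]
  have h : ((coeff (p ^ k - 1) V.formalInvDiff : ℤ) : ZMod p) =
      coeff (p ^ k - 1) ((V.map (Int.castRingHom (ZMod p))).formalInvDiff) := by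
    rw [← map_formalInvDiff, coeff_map, eq_intCast]
  rw [h, coeff_formalInvDiff_prime_pow_sub_one _ p hpm]
  exact pow_ne_zero _ hA

end WeierstrassCurve
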